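import Summits.BirchSwinnertonDyer.Rank1Residual.AdditivePotMult.QuadraticTwistTypeIVNormalForm
import HarnessLib

/-!
# THE FLIP: `c(W^{(d)}) = 3 ↔ c(W) = 1` at a place of type `IV` / `IV*` under a NON-square unit
# twist (row T-MIL-B = stage B of T-MIL-ODD, file B-2b; seat n1011-p08 GEN 3)

HONEST FRAMING (cell `b2b-bsdres`, run/shared/lean/b2b/bsd-rank1-residual/, verbatim in every
file): the goal of the cell is to DELETE the COMBINATION-SHAPED residual classes of the
Birch–Swinnerton-Dyer formula for ALL analytic-rank `≤ 1` elliptic curves over `ℚ` — "full BSD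
formula for every rank `≤ 1` curve in class `C`" assembled STRICTLY from published theorems — so
that the rank-`≤ 1` remainder becomes exactly the CONSTRUCTION-SHAPED classes, which are TYPED
(missing-input `Prop`s), NOT attempted. This is not "finishing BSD". Sub-classes X3♯(M) / X4(M)
(additive, base-change-and-descend): a RESEARCH ROUTE; they stay CONSTRUCTION-SHAPED; nothing is
booked by this file; no mark / label moved; no consumer binder (`hWR`, `hodd`, A65/A73) changes
before T-MIL-ODD stage C. THEOREMS ONLY: no definition, no named fact, no `sorry`. OUT OF THIS
ROW (said in every file): the wild sub-case `ℓ = 3 = p ∣ d_K` and `ℓ = 2` (the flip at an inert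
`ℓ = 2` needs the `twistModel` / Artin–Schreier argument, n1011-lit GEN 11 bind (F1)).

## What (skeleton `cells/n1011/skel/T-MIL-B.md` §1 (B2)(ii); referee-1 ACK-1 proviso (v):
## `IsUnit (2 : R)`, `Finite k`, odd characteristic explicit)

Let `R` be a HENSELIAN discrete valuation ring with FINITE residue field `k`, `2 ∈ Rˣ` (so `k`
has odd characteristic), fraction field `K`; `W/K` an elliptic curve with a MINIMAL `R`-model `J`
(`D • W = J ⊗ K`) in the type-`IV` (resp. `IV*`) normal form of Tate's algorithm, and `d ∈ Rˣ`
whose residue is a NON-square.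

* `localTamagawaNumber_quadraticTwist_eq_three_iff_eq_one_of_normalForm_IV` (and `…_IVstar`):
  **`c(W^{(d)}/K) = 3 ↔ c(W/K) = 1`** — the twist model `J^{(d)}` (B-2a
  `QuadraticTwistTypeIVNormalForm`) is a minimal normal form of the same type whose Step-5/8
  quadratic has a root iff that of `J` has none, and the exact index (Literature
  `NeronComponentIndexTypeIVExact` / `…IVstarExact`, Silverman *ATAEC* IV.9.4 Steps 5/8) reads
  `c` off the root;
* `localTamagawaNumber_quadraticTwist_dichotomy_of_normalForm_IV`: exactly one of `c(W)`,
  `c(W^{(d)})` is `3`, the other is `1`;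
* `padicValNat_localTamagawaNumber_add_quadraticTwist_of_normalForm_IV`:
  **`v₃(c(W)) + v₃(c(W^{(d)})) = 1`** — the `p = 3` entry of the local identity (L_ℓ)@p of the odd
  part of Milne's quadratic BSD-quotient identity at an INERT additive place `ℓ ∤ 2·3·d_K` of type
  `IV` (T-MIL-ODD skeleton §1 (A3): the base-change side there is `c_w = 3`, so `1 = 1 + 0`).

Corroborating print (not used as a fact): T. & V. Dokchitser, *Ann. Math.* 172 (2010) p. 580,
proof of Thm 3.3 Case 4c. References: Silverman *ATAEC* IV.9.4 Steps 5, 8 (PDF pp. 344, 346);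
*AEC* X.5 Cor. 5.4.
-/

noncomputable section

open scoped Classical

open WeierstrassCurve IsLocalRing Polynomial
  Literature.NumberTheory.EllipticCurves Literature.NumberTheory.EllipticCurves.LocalIndex
  Literature.NumberTheory.DiophantineGeometry.TateAlgorithm

namespace Summit.BirchSwinnertonDyer.Rank1Residual.AdditivePotMult

namespace TypeIVTwist

section DVR

variable {R : Type*} [CommRing R] [IsDomain R] [IsDiscreteValuationRing R]
  {K : Type*} [Field K] [Algebra R K] [IsFractionRing R K]

/-! ## §3 THE FLIP -/

/-- **THE FLIP at type `IV` (skeleton T-MIL-B §1 (B2)(ii)).** Let `R` be a Henselian discrete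
valuation ring with finite residue field of odd characteristic (`2 ∈ Rˣ`), `W/K` an elliptic curve
with a MINIMAL `R`-model `J` (`D • W = J ⊗ K`) in the type-`IV` normal form (`a₁, a₂ ∈ 𝔪`,
`a₃ = ϖγ`, `a₄ ∈ 𝔪²`, `a₆ = ϖ²ε`, `γ̄² + 4ε̄ ≠ 0`) and `d ∈ Rˣ` with `d̄` a NON-square. Then
`c(W^{(d)}/K) = 3 ↔ c(W/K) = 1`: the twist model `J^{(d)}` is a minimal type-`IV` normal form
(tree `isMinimal_quadraticTwist`) whose Step-5 quadratic has a root iff that of `J` has none, and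
Silverman *ATAEC* IV.9.4 Step 5 (exact form, `…TypeIVExact`) reads `c` off the root.
[cite: SilvermanATAEC1994, IV.9.4 Step 5 (PDF p. 344)] [cite: SilvermanAEC2009, X.5 Cor. 5.4] -/
theorem localTamagawaNumber_quadraticTwist_eq_three_iff_eq_one_of_normalForm_IV
    [HenselianLocalRing R] [Finite (ResidueField R)] (h2 : IsUnit (2 : R))
    (W : WeierstrassCurve K) [W.IsElliptic] (J : WeierstrassCurve R) (D : VariableChange K)
    (hJ : D • W = J.baseChange K) [(J.baseChange K).IsMinimal R]
    (h1 : J.a₁ ∈ maximalIdeal R) (ha₂ : J.a₂ ∈ maximalIdeal R) {ϖ γ ε : R} (hϖ : Irreducible ϖ)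
    (hγ : J.a₃ = ϖ * γ) (h4 : J.a₄ ∈ maximalIdeal R ^ 2) (hε : J.a₆ = ϖ ^ 2 * ε)
    (hdisc : residue R γ ^ 2 + 4 * residue R ε ≠ 0) (d : Rˣ)
    (hns : ¬ IsSquare (residue R (d : R))) :
    (W.quadraticTwist (algebraMap R K d)).localTamagawaNumber R = 3 ↔
      W.localTamagawaNumber R = 1 := by
  obtain ⟨w, hw⟩ := h2
  haveI : NeZero (2 : K) := ⟨two_ne_zero_of_isUnit_two R (hw ▸ w.isUnit)⟩
  haveI : NeZero (2 : ResidueField R) := ⟨(residue_units_inv_two R hw).1⟩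
  have hdK : algebraMap R K (d : R) ≠ 0 := algebraMap_units_ne_zero R d
  haveI : (W.quadraticTwist (algebraMap R K d)).IsElliptic := W.isElliptic_quadraticTwist hdK
  -- the twist model and its normal form
  set J' : WeierstrassCurve R :=
    ⟨0, (d : R) * J.b₂ * ↑w⁻¹ * ↑w⁻¹, 0, (d : R) ^ 2 * J.b₄ * ↑w⁻¹,
      (d : R) ^ 3 * J.b₆ * ↑w⁻¹ * ↑w⁻¹⟩ with hJ'def
  have hJ'K : J'.baseChange K = (J.baseChange K).quadraticTwist (algebraMap R K d) :=
    baseChange_twistModel_eq J w hw (d : R)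
  obtain ⟨h1', h2', hγ', h4', hε'⟩ := normalForm_IV_twistModel J h1 ha₂ hϖ hγ h4 hε w (d : R)
  haveI hmin' : (J'.baseChange K).IsMinimal R := by
    rw [hJ'K]; exact isMinimal_quadraticTwist R (J.baseChange K) (hw ▸ w.isUnit) d
  -- `D' • W^{(d)} = J' ⊗ K`
  have hJ' : (⟨D.u, algebraMap R K d * D.r, 0, 0⟩ : VariableChange K) •
      W.quadraticTwist (algebraMap R K d) = J'.baseChange K := by
    rw [hJ'K, ← hJ, quadraticTwist_smul]
  have hdisc' : residue R (0 : R) ^ 2 +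
      4 * residue R ((d : R) ^ 3 * ↑w⁻¹ * ↑w⁻¹ * (γ ^ 2 + 4 * ε)) ≠ 0 := by
    rw [disc_twistModel_eq w hw]
    exact mul_ne_zero (pow_ne_zero 2 (residue_units_ne_zero R d))
      (mul_ne_zero (residue_units_ne_zero R d) hdisc)
  rw [localTamagawaNumber_eq_three_iff_exists_root_of_normalForm_IV (W.quadraticTwist _) J' _ hJ'
      h1' h2' hϖ hγ' h4' hε' hdisc',
    exists_root_twistModel_iff_not w hw hns hdisc,
    localTamagawaNumber_eq_one_iff_forall_not_root_of_normalForm_IV W J D hJ h1 ha₂ hϖ hγ h4 hε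
      hdisc, not_exists]

/-- **THE FLIP at type `IV*`** (skeleton §1 (B2)(ii); IV* normal form `a₁ ∈ 𝔪`, `a₂ ∈ 𝔪²`,
`a₃ = ϖ²γ`, `a₄ ∈ 𝔪³`, `a₆ = ϖ⁴ε`, `γ̄² + 4ε̄ ≠ 0`; `d̄` a non-square):
`c(W^{(d)}/K) = 3 ↔ c(W/K) = 1`. [cite: SilvermanATAEC1994, IV.9.4 Step 8 (PDF p. 346)] [cite: SilvermanAEC2009, X.5 Cor. 5.4] -/
theorem localTamagawaNumber_quadraticTwist_eq_three_iff_eq_one_of_normalForm_IVstar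
    [HenselianLocalRing R] [Finite (ResidueField R)] (h2 : IsUnit (2 : R))
    (W : WeierstrassCurve K) [W.IsElliptic] (J : WeierstrassCurve R) (D : VariableChange K)
    (hJ : D • W = J.baseChange K) [(J.baseChange K).IsMinimal R]
    (h1 : J.a₁ ∈ maximalIdeal R) (ha₂ : J.a₂ ∈ maximalIdeal R ^ 2) {ϖ γ ε : R}
    (hϖ : Irreducible ϖ) (hγ : J.a₃ = ϖ ^ 2 * γ) (h4 : J.a₄ ∈ maximalIdeal R ^ 3)
    (hε : J.a₆ = ϖ ^ 4 * ε) (hdisc : residue R γ ^ 2 + 4 * residue R ε ≠ 0) (d : Rˣ)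
    (hns : ¬ IsSquare (residue R (d : R))) :
    (W.quadraticTwist (algebraMap R K d)).localTamagawaNumber R = 3 ↔
      W.localTamagawaNumber R = 1 := by
  obtain ⟨w, hw⟩ := h2
  haveI : NeZero (2 : K) := ⟨two_ne_zero_of_isUnit_two R (hw ▸ w.isUnit)⟩
  haveI : NeZero (2 : ResidueField R) := ⟨(residue_units_inv_two R hw).1⟩
  have hdK : algebraMap R K (d : R) ≠ 0 := algebraMap_units_ne_zero R d
  haveI : (W.quadraticTwist (algebraMap R K d)).IsElliptic := W.isElliptic_quadraticTwist hdK
  set J' : WeierstrassCurve R :=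
    ⟨0, (d : R) * J.b₂ * ↑w⁻¹ * ↑w⁻¹, 0, (d : R) ^ 2 * J.b₄ * ↑w⁻¹,
      (d : R) ^ 3 * J.b₆ * ↑w⁻¹ * ↑w⁻¹⟩ with hJ'def
  have hJ'K : J'.baseChange K = (J.baseChange K).quadraticTwist (algebraMap R K d) :=
    baseChange_twistModel_eq J w hw (d : R)
  obtain ⟨h1', h2', hγ', h4', hε'⟩ :=
    normalForm_IVstar_twistModel J h1 ha₂ hϖ hγ h4 hε w (d : R)
  haveI hmin' : (J'.baseChange K).IsMinimal R := by
    rw [hJ'K]; exact isMinimal_quadraticTwist R (J.baseChange K) (hw ▸ w.isUnit) d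
  have hJ' : (⟨D.u, algebraMap R K d * D.r, 0, 0⟩ : VariableChange K) •
      W.quadraticTwist (algebraMap R K d) = J'.baseChange K := by
    rw [hJ'K, ← hJ, quadraticTwist_smul]
  have hdisc' : residue R (0 : R) ^ 2 +
      4 * residue R ((d : R) ^ 3 * ↑w⁻¹ * ↑w⁻¹ * (γ ^ 2 + 4 * ε)) ≠ 0 := by
    rw [disc_twistModel_eq w hw]
    exact mul_ne_zero (pow_ne_zero 2 (residue_units_ne_zero R d))
      (mul_ne_zero (residue_units_ne_zero R d) hdisc)
  rw [localTamagawaNumber_eq_three_iff_exists_root_of_normalForm_IVstar (W.quadraticTwist _) J' _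
      hJ' h1' h2' hϖ hγ' h4' hε' hdisc',
    exists_root_twistModel_iff_not w hw hns hdisc,
    localTamagawaNumber_eq_one_iff_forall_not_root_of_normalForm_IVstar W J D hJ h1 ha₂ hϖ hγ h4
      hε hdisc, not_exists]

/-- **Exactly one of `c(W)`, `c(W^{(d)})` equals `3`** at type `IV` (non-square unit twist; both
values lie in `{1, 3}`): the dichotomy form of the flip. [cite: SilvermanATAEC1994, IV.9.4 Step 5 (PDF p. 344)] -/
theorem localTamagawaNumber_quadraticTwist_dichotomy_of_normalForm_IV
    [HenselianLocalRing R] [Finite (ResidueField R)] (h2 : IsUnit (2 : R))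
    (W : WeierstrassCurve K) [W.IsElliptic] (J : WeierstrassCurve R) (D : VariableChange K)
    (hJ : D • W = J.baseChange K) [(J.baseChange K).IsMinimal R]
    (h1 : J.a₁ ∈ maximalIdeal R) (ha₂ : J.a₂ ∈ maximalIdeal R) {ϖ γ ε : R} (hϖ : Irreducible ϖ)
    (hγ : J.a₃ = ϖ * γ) (h4 : J.a₄ ∈ maximalIdeal R ^ 2) (hε : J.a₆ = ϖ ^ 2 * ε)
    (hdisc : residue R γ ^ 2 + 4 * residue R ε ≠ 0) (d : Rˣ)
    (hns : ¬ IsSquare (residue R (d : R))) :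
    (W.localTamagawaNumber R = 3 ∧ (W.quadraticTwist (algebraMap R K d)).localTamagawaNumber R = 1) ∨
      (W.localTamagawaNumber R = 1 ∧
        (W.quadraticTwist (algebraMap R K d)).localTamagawaNumber R = 3) := by
  have hflip := localTamagawaNumber_quadraticTwist_eq_three_iff_eq_one_of_normalForm_IV h2 W J D
    hJ h1 ha₂ hϖ hγ h4 hε hdisc d hns
  have hΔ : J.Δ ≠ 0 := by
    intro h0
    have : (J.baseChange K).Δ = 0 := by
      simp only [WeierstrassCurve.baseChange, WeierstrassCurve.map_Δ, h0, map_zero]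
    rw [← hJ, WeierstrassCurve.variableChange_Δ] at this
    exact mul_ne_zero (pow_ne_zero _ (Units.ne_zero _)) (W.coe_Δ' ▸ W.Δ'.ne_zero) this
  -- `c(W) ∈ {1,3}` read on the normal form
  have hWmem : W.localTamagawaNumber R = 1 ∨ W.localTamagawaNumber R = 3 := by
    rw [localTamagawaNumber_eq_index_of_smul_eq_baseChange W J D hJ]
    by_cases hr : ∃ r : ResidueField R, r ^ 2 + residue R γ * r - residue R ε = 0
    · exact Or.inr ((index_eq_three_iff_exists_root_of_normalForm_IV J h1 ha₂ hϖ hγ h4 hε hdisc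
        hΔ).mpr hr)
    · rw [not_exists] at hr
      exact Or.inl (index_eq_one_of_forall_not_root_of_normalForm_IV J h1 ha₂ hϖ hγ h4 hε hr)
  -- and `c(W^{(d)}) ∈ {1,3}` likewise, through the flip
  rcases hWmem with hW1 | hW3
  · exact Or.inr ⟨hW1, hflip.mpr hW1⟩
  · refine Or.inl ⟨hW3, ?_⟩
    -- `c(W^{(d)}) ≠ 3` (else `c(W) = 1`), and it lies in `{1,3}`: run the flip from the twist side
    obtain ⟨w, hw⟩ := h2
    haveI : NeZero (2 : K) := ⟨two_ne_zero_of_isUnit_two R (hw ▸ w.isUnit)⟩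
    haveI : NeZero (2 : ResidueField R) := ⟨(residue_units_inv_two R hw).1⟩
    have hdK : algebraMap R K (d : R) ≠ 0 := algebraMap_units_ne_zero R d
    haveI : (W.quadraticTwist (algebraMap R K d)).IsElliptic := W.isElliptic_quadraticTwist hdK
    set J' : WeierstrassCurve R :=
      ⟨0, (d : R) * J.b₂ * ↑w⁻¹ * ↑w⁻¹, 0, (d : R) ^ 2 * J.b₄ * ↑w⁻¹,
        (d : R) ^ 3 * J.b₆ * ↑w⁻¹ * ↑w⁻¹⟩ with hJ'def
    have hJ'K : J'.baseChange K = (J.baseChange K).quadraticTwist (algebraMap R K d) :=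
      baseChange_twistModel_eq J w hw (d : R)
    obtain ⟨h1', h2', hγ', h4', hε'⟩ := normalForm_IV_twistModel J h1 ha₂ hϖ hγ h4 hε w (d : R)
    haveI hmin' : (J'.baseChange K).IsMinimal R := by
      rw [hJ'K]; exact isMinimal_quadraticTwist R (J.baseChange K) (hw ▸ w.isUnit) d
    have hJ' : (⟨D.u, algebraMap R K d * D.r, 0, 0⟩ : VariableChange K) •
        W.quadraticTwist (algebraMap R K d) = J'.baseChange K := by
      rw [hJ'K, ← hJ, quadraticTwist_smul]
    have hdisc' : residue R (0 : R) ^ 2 +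
        4 * residue R ((d : R) ^ 3 * ↑w⁻¹ * ↑w⁻¹ * (γ ^ 2 + 4 * ε)) ≠ 0 := by
      rw [disc_twistModel_eq w hw]
      exact mul_ne_zero (pow_ne_zero 2 (residue_units_ne_zero R d))
        (mul_ne_zero (residue_units_ne_zero R d) hdisc)
    rw [localTamagawaNumber_eq_one_iff_forall_not_root_of_normalForm_IV (W.quadraticTwist _) J' _
        hJ' h1' h2' hϖ hγ' h4' hε' hdisc', ← not_exists, exists_root_twistModel_iff_not w hw hns hdisc,
      not_not]
    exact (index_eq_three_iff_exists_root_of_normalForm_IV (K := K) J h1 ha₂ hϖ hγ h4 hε hdisc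
      hΔ).mp ((localTamagawaNumber_eq_index_of_smul_eq_baseChange W J D hJ).symm.trans hW3)

/-- **`v₃(c(W)) + v₃(c(W^{(d)})) = 1`** at type `IV` under a non-square unit twist — the `p = 3`
entry of (L_ℓ)@p at an INERT additive place of type `IV` (T-MIL-ODD skeleton §1 (A3): `1 = 1 + 0`
after the unramified side `c_w = 3`). [cite: SilvermanATAEC1994, IV.9.4 Step 5 (PDF p. 344)] -/
theorem padicValNat_localTamagawaNumber_add_quadraticTwist_of_normalForm_IV
    [HenselianLocalRing R] [Finite (ResidueField R)] (h2 : IsUnit (2 : R))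
    (W : WeierstrassCurve K) [W.IsElliptic] (J : WeierstrassCurve R) (D : VariableChange K)
    (hJ : D • W = J.baseChange K) [(J.baseChange K).IsMinimal R]
    (h1 : J.a₁ ∈ maximalIdeal R) (ha₂ : J.a₂ ∈ maximalIdeal R) {ϖ γ ε : R} (hϖ : Irreducible ϖ)
    (hγ : J.a₃ = ϖ * γ) (h4 : J.a₄ ∈ maximalIdeal R ^ 2) (hε : J.a₆ = ϖ ^ 2 * ε)
    (hdisc : residue R γ ^ 2 + 4 * residue R ε ≠ 0) (d : Rˣ)
    (hns : ¬ IsSquare (residue R (d : R))) :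
    padicValNat 3 (W.localTamagawaNumber R) +
      padicValNat 3 ((W.quadraticTwist (algebraMap R K d)).localTamagawaNumber R) = 1 := by
  rcases localTamagawaNumber_quadraticTwist_dichotomy_of_normalForm_IV h2 W J D hJ h1 ha₂ hϖ hγ h4
    hε hdisc d hns with ⟨ha, hb⟩ | ⟨ha, hb⟩ <;> rw [ha, hb] <;> simp

/-- **Exactly one of `c(W)`, `c(W^{(d)})` equals `3`** at type `IV*` (non-square unit twist; both
values lie in `{1, 3}`): the dichotomy form of the flip. [cite: SilvermanATAEC1994, IV.9.4 Step 8 (PDF p. 346)] -/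
theorem localTamagawaNumber_quadraticTwist_dichotomy_of_normalForm_IVstar
    [HenselianLocalRing R] [Finite (ResidueField R)] (h2 : IsUnit (2 : R))
    (W : WeierstrassCurve K) [W.IsElliptic] (J : WeierstrassCurve R) (D : VariableChange K)
    (hJ : D • W = J.baseChange K) [(J.baseChange K).IsMinimal R]
    (h1 : J.a₁ ∈ maximalIdeal R) (ha₂ : J.a₂ ∈ maximalIdeal R ^ 2) {ϖ γ ε : R}
    (hϖ : Irreducible ϖ) (hγ : J.a₃ = ϖ ^ 2 * γ) (h4 : J.a₄ ∈ maximalIdeal R ^ 3)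
    (hε : J.a₆ = ϖ ^ 4 * ε)
    (hdisc : residue R γ ^ 2 + 4 * residue R ε ≠ 0) (d : Rˣ)
    (hns : ¬ IsSquare (residue R (d : R))) :
    (W.localTamagawaNumber R = 3 ∧ (W.quadraticTwist (algebraMap R K d)).localTamagawaNumber R = 1) ∨
      (W.localTamagawaNumber R = 1 ∧
        (W.quadraticTwist (algebraMap R K d)).localTamagawaNumber R = 3) := by
  have hflip := localTamagawaNumber_quadraticTwist_eq_three_iff_eq_one_of_normalForm_IVstar h2 W J
    D hJ h1 ha₂ hϖ hγ h4 hε hdisc d hns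
  have hΔ : J.Δ ≠ 0 := by
    intro h0
    have : (J.baseChange K).Δ = 0 := by
      simp only [WeierstrassCurve.baseChange, WeierstrassCurve.map_Δ, h0, map_zero]
    rw [← hJ, WeierstrassCurve.variableChange_Δ] at this
    exact mul_ne_zero (pow_ne_zero _ (Units.ne_zero _)) (W.coe_Δ' ▸ W.Δ'.ne_zero) this
  -- `c(W) ∈ {1,3}` read on the normal form
  have hWmem : W.localTamagawaNumber R = 1 ∨ W.localTamagawaNumber R = 3 := by
    rw [localTamagawaNumber_eq_index_of_smul_eq_baseChange W J D hJ]
    by_cases hr : ∃ r : ResidueField R, r ^ 2 + residue R γ * r - residue R ε = 0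
    · exact Or.inr ((index_eq_three_iff_exists_root_of_normalForm_IVstar J h1 ha₂ hϖ hγ h4 hε
        hdisc hΔ).mpr hr)
    · rw [not_exists] at hr
      exact Or.inl (index_eq_one_of_forall_not_root_of_normalForm_IVstar J h1 ha₂ hϖ hγ h4 hε hr)
  -- and `c(W^{(d)}) ∈ {1,3}` likewise, through the flip
  rcases hWmem with hW1 | hW3
  · exact Or.inr ⟨hW1, hflip.mpr hW1⟩
  · refine Or.inl ⟨hW3, ?_⟩
    -- `c(W^{(d)}) ≠ 3` (else `c(W) = 1`), and it lies in `{1,3}`: run the flip from the twist side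
    obtain ⟨w, hw⟩ := h2
    haveI : NeZero (2 : K) := ⟨two_ne_zero_of_isUnit_two R (hw ▸ w.isUnit)⟩
    haveI : NeZero (2 : ResidueField R) := ⟨(residue_units_inv_two R hw).1⟩
    have hdK : algebraMap R K (d : R) ≠ 0 := algebraMap_units_ne_zero R d
    haveI : (W.quadraticTwist (algebraMap R K d)).IsElliptic := W.isElliptic_quadraticTwist hdK
    set J' : WeierstrassCurve R :=
      ⟨0, (d : R) * J.b₂ * ↑w⁻¹ * ↑w⁻¹, 0, (d : R) ^ 2 * J.b₄ * ↑w⁻¹,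
        (d : R) ^ 3 * J.b₆ * ↑w⁻¹ * ↑w⁻¹⟩ with hJ'def
    have hJ'K : J'.baseChange K = (J.baseChange K).quadraticTwist (algebraMap R K d) :=
      baseChange_twistModel_eq J w hw (d : R)
    obtain ⟨h1', h2', hγ', h4', hε'⟩ :=
      normalForm_IVstar_twistModel J h1 ha₂ hϖ hγ h4 hε w (d : R)
    haveI hmin' : (J'.baseChange K).IsMinimal R := by
      rw [hJ'K]; exact isMinimal_quadraticTwist R (J.baseChange K) (hw ▸ w.isUnit) d
    have hJ' : (⟨D.u, algebraMap R K d * D.r, 0, 0⟩ : VariableChange K) •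
        W.quadraticTwist (algebraMap R K d) = J'.baseChange K := by
      rw [hJ'K, ← hJ, quadraticTwist_smul]
    have hdisc' : residue R (0 : R) ^ 2 +
        4 * residue R ((d : R) ^ 3 * ↑w⁻¹ * ↑w⁻¹ * (γ ^ 2 + 4 * ε)) ≠ 0 := by
      rw [disc_twistModel_eq w hw]
      exact mul_ne_zero (pow_ne_zero 2 (residue_units_ne_zero R d))
        (mul_ne_zero (residue_units_ne_zero R d) hdisc)
    rw [localTamagawaNumber_eq_one_iff_forall_not_root_of_normalForm_IVstar (W.quadraticTwist _) J'
        _ hJ' h1' h2' hϖ hγ' h4' hε' hdisc', ← not_exists,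
      exists_root_twistModel_iff_not w hw hns hdisc, not_not]
    exact (index_eq_three_iff_exists_root_of_normalForm_IVstar (K := K) J h1 ha₂ hϖ hγ h4 hε hdisc
      hΔ).mp ((localTamagawaNumber_eq_index_of_smul_eq_baseChange W J D hJ).symm.trans hW3)

/-- **`v₃(c(W)) + v₃(c(W^{(d)})) = 1`** at type `IV*` under a non-square unit twist (the `p = 3`
entry of (L_ℓ)@p at an INERT additive place of type `IV*`).
[cite: SilvermanATAEC1994, IV.9.4 Step 8 (PDF p. 346)] -/
theorem padicValNat_localTamagawaNumber_add_quadraticTwist_of_normalForm_IVstar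
    [HenselianLocalRing R] [Finite (ResidueField R)] (h2 : IsUnit (2 : R))
    (W : WeierstrassCurve K) [W.IsElliptic] (J : WeierstrassCurve R) (D : VariableChange K)
    (hJ : D • W = J.baseChange K) [(J.baseChange K).IsMinimal R]
    (h1 : J.a₁ ∈ maximalIdeal R) (ha₂ : J.a₂ ∈ maximalIdeal R ^ 2) {ϖ γ ε : R}
    (hϖ : Irreducible ϖ) (hγ : J.a₃ = ϖ ^ 2 * γ) (h4 : J.a₄ ∈ maximalIdeal R ^ 3)
    (hε : J.a₆ = ϖ ^ 4 * ε)
    (hdisc : residue R γ ^ 2 + 4 * residue R ε ≠ 0) (d : Rˣ)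
    (hns : ¬ IsSquare (residue R (d : R))) :
    padicValNat 3 (W.localTamagawaNumber R) +
      padicValNat 3 ((W.quadraticTwist (algebraMap R K d)).localTamagawaNumber R) = 1 := by
  rcases localTamagawaNumber_quadraticTwist_dichotomy_of_normalForm_IVstar h2 W J D hJ h1 ha₂ hϖ hγ
    h4 hε hdisc d hns with ⟨ha, hb⟩ | ⟨ha, hb⟩ <;> rw [ha, hb] <;> simp

end DVR

end TypeIVTwist

end Summit.BirchSwinnertonDyer.Rank1Residual.AdditivePotMult

end
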